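import Literature.Geometry.Riemannian.ThreeShrinkerDegenerateExpMap
import Literature.Geometry.Riemannian.SphereLocalIsometry
import HarnessLib

/-!
# Degenerate three-dimensional shrinkers: comparison of `exp_p^* g` with the round cylinder
# (towards the developing map `S²(√2) × ℝ → M`)

Continuation of `ThreeShrinkerDegenerateExpMap` (degenerate case of Munteanu–Wang 2016, Thm. 1.2:
a complete noncompact non-flat three-dimensional shrinker is a quotient of `S² × ℝ`). On a complete
connected normalised shrinker of dimension three with `Ric ≥ 0`, `S ≡ 1` and a null vector of
`Ric`, Cartan's formula (`val_mfderiv_expMap_sq`) reads, in an orthonormal frame `(a₁, a₂, ν)` at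
`p` with `ν` null (`val_mfderiv_expMap_coords`):
`|d(exp_p)_{w₁a₁+w₂a₂+σν}(x₁a₁+x₂a₂+cν)|² = c² + (x·w)²/r² + 2 sin²(r/√2)(x×w)²/r⁴`, `r = |w|`.
On the other side, for the round unit sphere `S² ⊂ ℝ³` and `g_round`-orthonormal `ε₀, ε₁ ∈ T_oS²`
the tree's Cartan formula in constant curvature `1` (`ConstantCurvatureJacobi`) reads
`|d(exp^{S²}_o)_l λ|² = (λ·l)²/|l|² + sin²|l| (λ×l)²/|l|⁴` (`sphere_val_mfderiv_coords`). Hence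
**`val_mfderiv_expMap_eq_two_mul_sphere`**: with `v = √2(l⁰a₁ + l¹a₂) + √2 τ ν`,
`ξ = √2(λ⁰a₁ + λ¹a₂) + √2 α ν`,

  `|d(exp_p)_v ξ|²_g = 2 |d(exp^{S²}_o)_l λ|²_{g_round} + 2 α²`,

i.e. `exp_p^* g` is the metric `2 g_{S²} + dz²` of `S²(√2) × ℝ` read through `exp^{S²}_o × id`
— the pointwise identity behind the local isometry `exp_p ∘ ι ∘ (exp^{C}_õ)⁻¹` from the model
cylinder (`ThreeShrinkerDegenerateDevelopingMap`). Also: `exists_roundMetric_orthonormal` (a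
`g_round`-orthonormal pair in `T_oS²`) and `roundMetric_eq_coords` (`g_round` in these coordinates).

Everything is proved; no new definitions (D-0026).

## References

* O. Munteanu, J. Wang, arXiv:1606.01861, Thm. 1.2 (p. 3). [MunteanuWang2016]
* M. P. do Carmo, *Riemannian Geometry*, Birkhäuser 1992, Ch. 8, Thm. 2.1 (Cartan). [doCarmo1992]
* I. Chavel, *Riemannian Geometry*, 2nd ed., CUP 2006, Thm. II.6.3, §III.1. [Chavel2006]
* J. M. Lee, *Introduction to Riemannian Manifolds*, 2nd ed., Springer 2018, Prop. 10.12,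
  Thm. 10.14. [Lee2018]
-/

noncomputable section

open Bundle Set Function Filter Module Metric
open scoped Manifold ContDiff Topology NNReal RealInnerProductSpace

namespace Literature.Geometry.Riemannian

open Lorentzian Lorentzian.PseudoRiemannianMetric

/-! ### The round `S² ⊂ ℝ³`: instances and Cartan's formula in coordinates -/

section SphereSide

/-- `dim ℝ³ = 2 + 1` (the instance making `S² ⊂ ℝ³` a `2`-manifold). [folklore] -/
instance fact_finrank_euclideanSpace_three :
    Fact (finrank ℝ (EuclideanSpace ℝ (Fin 3)) = 2 + 1) := ⟨finrank_euclideanSpace_fin⟩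

/-- The Levi-Civita connection of the round `S²`. [folklore] -/
instance hasLeviCivita_roundMetric_two :
    (roundMetric (n := 2) (EuclideanSpace ℝ (Fin 3))).HasLeviCivita :=
  (roundMetric (n := 2) (EuclideanSpace ℝ (Fin 3))).hasLeviCivita

attribute [local instance] contMDiffCovariantDerivative_roundMetric_one
  contMDiffCovariantDerivative_roundMetric_top

/-- Shorthand: the round metric of `S² ⊂ ℝ³`. -/
local notation "gS" => roundMetric (n := 2) (EuclideanSpace ℝ (Fin 3))

/-- Shorthand: the model plane of `S²`. -/
local notation "E2" => EuclideanSpace ℝ (Fin 2)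

/-- **A `g_round`-orthonormal pair in `T_oS²`** (an orthonormal basis of the inner product space
`(T_oS², g_round)`, Mathlib's `stdOrthonormalBasis` for `riemannianBundle`). [folklore] -/
theorem exists_roundMetric_orthonormal (o : sphere (0 : EuclideanSpace ℝ (Fin 3)) 1) :
    ∃ ε₀ ε₁ : TangentSpace (𝓡 2) o,
      (gS).val o ε₀ ε₀ = 1 ∧ (gS).val o ε₁ ε₁ = 1 ∧ (gS).val o ε₀ ε₁ = 0 := by
  letI r1 := (gS).riemannianBundle isRiemannian_roundMetric
  haveI : FiniteDimensional ℝ (TangentSpace (𝓡 2) o) :=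
    inferInstanceAs (FiniteDimensional ℝ (EuclideanSpace ℝ (Fin 2)))
  have h1 : finrank ℝ (TangentSpace (𝓡 2) o) = 2 := finrank_euclideanSpace_fin
  set b := (stdOrthonormalBasis ℝ (TangentSpace (𝓡 2) o)).reindex (finCongr h1) with hb
  refine ⟨b 0, b 1, ?_, ?_, ?_⟩
  · rw [← (gS).inner_eq isRiemannian_roundMetric, real_inner_self_eq_norm_sq, b.orthonormal.1 0,
      one_pow]
  · rw [← (gS).inner_eq isRiemannian_roundMetric, real_inner_self_eq_norm_sq, b.orthonormal.1 1,
      one_pow]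
  · rw [← (gS).inner_eq isRiemannian_roundMetric]
    exact b.orthonormal.2 (by decide)

/-- Expansion in a `g_round`-orthonormal pair: `λ = g(λ,ε₀) ε₀ + g(λ,ε₁) ε₁` (`T_oS²` has
dimension `2`). [folklore] -/
theorem eq_coords_roundMetric {o : sphere (0 : EuclideanSpace ℝ (Fin 3)) 1}
    {ε₀ ε₁ : TangentSpace (𝓡 2) o}
    (h00 : (gS).val o ε₀ ε₀ = 1) (h11 : (gS).val o ε₁ ε₁ = 1) (h01 : (gS).val o ε₀ ε₁ = 0)
    (lam : TangentSpace (𝓡 2) o) : lam = (gS).val o lam ε₀ • ε₀ + (gS).val o lam ε₁ • ε₁ := by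
  have h10 : (gS).val o ε₁ ε₀ = 0 := by rw [(gS).symm o]; exact h01
  -- `ε₀, ε₁` are linearly independent, hence a basis of the plane `T_oS²`
  have hli : LinearIndependent ℝ (![ε₀, ε₁] : Fin 2 → TangentSpace (𝓡 2) o) := by
    refine LinearIndependent.pair_iff.2 fun s t hst ↦ ?_
    have e0 := congrArg (fun v ↦ (gS).val o v ε₀) hst
    have e1 := congrArg (fun v ↦ (gS).val o v ε₁) hst
    simp only [map_add, map_smul, _root_.add_apply, FunLike.coe_smul, Pi.smul_apply, smul_eq_mul,
      h00, h10, h01, h11, map_zero, _root_.zero_apply, mul_one, mul_zero, add_zero, zero_add] at e0 e1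
    exact ⟨e0, e1⟩
  haveI : Module.Finite ℝ (TangentSpace (𝓡 2) o) := inferInstanceAs (Module.Finite ℝ E2)
  have hcard : Fintype.card (Fin 2) = finrank ℝ (TangentSpace (𝓡 2) o) := by
    change Fintype.card (Fin 2) = finrank ℝ E2
    simp
  set b : Basis (Fin 2) ℝ (TangentSpace (𝓡 2) o) := basisOfLinearIndependentOfCardEqFinrank hli hcard
    with hb_def
  have hb : ⇑b = ![ε₀, ε₁] := coe_basisOfLinearIndependentOfCardEqFinrank hli hcard
  have hsum := b.sum_repr lam
  rw [Fin.sum_univ_two, hb] at hsum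
  have hb0 : (![ε₀, ε₁] : Fin 2 → TangentSpace (𝓡 2) o) 0 = ε₀ := rfl
  have hb1 : (![ε₀, ε₁] : Fin 2 → TangentSpace (𝓡 2) o) 1 = ε₁ := rfl
  rw [hb0, hb1] at hsum
  -- the coefficients are the `g`-components
  have c0 := congrArg (fun v ↦ (gS).val o v ε₀) hsum
  have c1 := congrArg (fun v ↦ (gS).val o v ε₁) hsum
  simp only [map_add, map_smul, _root_.add_apply, FunLike.coe_smul, Pi.smul_apply, smul_eq_mul,
    h00, h10, h01, h11, mul_one, mul_zero, add_zero, zero_add] at c0 c1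
  rw [← c0, ← c1]
  exact hsum.symm

/-- `g_round` in orthonormal coordinates: `g(λ, l) = λ⁰l⁰ + λ¹l¹`. [folklore] -/
theorem roundMetric_eq_coords {o : sphere (0 : EuclideanSpace ℝ (Fin 3)) 1}
    {ε₀ ε₁ : TangentSpace (𝓡 2) o}
    (h00 : (gS).val o ε₀ ε₀ = 1) (h11 : (gS).val o ε₁ ε₁ = 1) (h01 : (gS).val o ε₀ ε₁ = 0)
    (lam l : TangentSpace (𝓡 2) o) :
    (gS).val o lam l = (gS).val o lam ε₀ * (gS).val o l ε₀ + (gS).val o lam ε₁ * (gS).val o l ε₁ := by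
  have h := congrArg (fun v ↦ (gS).val o lam v) (eq_coords_roundMetric h00 h11 h01 l)
  simp only [map_add, map_smul, smul_eq_mul] at h
  rw [h]
  ring

/-- **Cartan's formula for the round `S²` in coordinates.** For `g_round`-orthonormal `ε₀, ε₁` at
`o` and `l, λ ∈ T_oS²` with coordinates `lⁱ = g(l, εᵢ)`, `λⁱ = g(λ, εᵢ)`, `L = (l⁰)² + (l¹)² ≠ 0`:
`|d(exp_o)_l λ|² = (λ⁰l⁰+λ¹l¹)²/L + sin²(√L) (λ⁰l¹ − λ¹l⁰)²/L²`
(`val_mfderiv_expMap_self_of_curvature_one` for the round sphere and Lagrange's identity).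
[cite: Lee2018, Prop. 10.12] -/
theorem sphere_val_mfderiv_coords {o : sphere (0 : EuclideanSpace ℝ (Fin 3)) 1}
    {ε₀ ε₁ : TangentSpace (𝓡 2) o}
    (h00 : (gS).val o ε₀ ε₀ = 1) (h11 : (gS).val o ε₁ ε₁ = 1) (h01 : (gS).val o ε₀ ε₁ = 0)
    {l : TangentSpace (𝓡 2) o} (hl : (gS).val o l ε₀ ^ 2 + (gS).val o l ε₁ ^ 2 ≠ 0)
    (lam : TangentSpace (𝓡 2) o) :
    (gS).val (SphereLocalIsometry.sphereExp (EuclideanSpace ℝ (Fin 3)) 2 o l)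
      (mfderiv 𝓘(ℝ, E2) (𝓡 2) (SphereLocalIsometry.sphereExp (EuclideanSpace ℝ (Fin 3)) 2 o) l lam)
      (mfderiv 𝓘(ℝ, E2) (𝓡 2) (SphereLocalIsometry.sphereExp (EuclideanSpace ℝ (Fin 3)) 2 o) l lam) =
      ((gS).val o lam ε₀ * (gS).val o l ε₀ + (gS).val o lam ε₁ * (gS).val o l ε₁) ^ 2 /
          ((gS).val o l ε₀ ^ 2 + (gS).val o l ε₁ ^ 2) +
        Real.sin (Real.sqrt ((gS).val o l ε₀ ^ 2 + (gS).val o l ε₁ ^ 2)) ^ 2 *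
          ((gS).val o lam ε₀ * (gS).val o l ε₁ - (gS).val o lam ε₁ * (gS).val o l ε₀) ^ 2 /
          ((gS).val o l ε₀ ^ 2 + (gS).val o l ε₁ ^ 2) ^ 2 := by
  have hl0 : (l : E2) ≠ 0 := by
    intro hz
    apply hl
    have hz' : l = (0 : TangentSpace (𝓡 2) o) := hz
    rw [hz', map_zero, _root_.zero_apply, _root_.zero_apply]
    ring
  have h := val_mfderiv_expMap_self_of_curvature_one (I := 𝓡 2) (g := gS)
    isRiemannian_roundMetric SphereLocalIsometry.hasConstantSectionalCurvatureWith_roundMetric_leviCivita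
    SphereLocalIsometry.isLocallyContMDiff_roundMetric_one isGeodesicallyComplete_roundMetric o hl0 lam
  have hll : (gS).val o l l = (gS).val o l ε₀ ^ 2 + (gS).val o l ε₁ ^ 2 := by
    rw [roundMetric_eq_coords h00 h11 h01 l l]; ring
  have hml : (gS).val o lam l =
      (gS).val o lam ε₀ * (gS).val o l ε₀ + (gS).val o lam ε₁ * (gS).val o l ε₁ :=
    roundMetric_eq_coords h00 h11 h01 lam l
  have hmm2 : (gS).val o lam lam = (gS).val o lam ε₀ ^ 2 + (gS).val o lam ε₁ ^ 2 := by
    rw [roundMetric_eq_coords h00 h11 h01 lam lam]; ring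
  have h' : (gS).val (SphereLocalIsometry.sphereExp (EuclideanSpace ℝ (Fin 3)) 2 o l)
      (mfderiv 𝓘(ℝ, E2) (𝓡 2) (SphereLocalIsometry.sphereExp (EuclideanSpace ℝ (Fin 3)) 2 o) l lam)
      (mfderiv 𝓘(ℝ, E2) (𝓡 2) (SphereLocalIsometry.sphereExp (EuclideanSpace ℝ (Fin 3)) 2 o) l lam) =
      (gS).val o lam l ^ 2 / (gS).val o l l +
        ((gS).val o lam lam - (gS).val o lam l ^ 2 / (gS).val o l l) / (gS).val o l l *
          Real.sin (Real.sqrt ((gS).val o l l)) ^ 2 := h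
  rw [h', hll, hml, hmm2]
  field_simp
  ring

/-- `exp_o 0 = o` (the zero of `T_oS²`). [folklore] -/
theorem sphereExp_zero' (o : sphere (0 : EuclideanSpace ℝ (Fin 3)) 1) :
    SphereLocalIsometry.sphereExp (EuclideanSpace ℝ (Fin 3)) 2 o (0 : TangentSpace (𝓡 2) o) = o :=
  SphereLocalIsometry.sphereExp_zero o

/-- `d(exp_o)_0 = id` on the round sphere, applied. [folklore] -/
theorem sphere_mfderiv_zero_apply (o : sphere (0 : EuclideanSpace ℝ (Fin 3)) 1)
    (lam : TangentSpace (𝓡 2) o) :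
    mfderiv 𝓘(ℝ, E2) (𝓡 2) (SphereLocalIsometry.sphereExp (EuclideanSpace ℝ (Fin 3)) 2 o)
      (0 : TangentSpace (𝓡 2) o) lam = lam := by
  have h := mfderiv_expMap_zero (cov := (gS).leviCivita) (I := 𝓡 2) o
  change mfderiv 𝓘(ℝ, E2) (𝓡 2) (SphereLocalIsometry.sphereExp (EuclideanSpace ℝ (Fin 3)) 2 o) 0 =
    _ at h
  change mfderiv 𝓘(ℝ, E2) (𝓡 2) (SphereLocalIsometry.sphereExp (EuclideanSpace ℝ (Fin 3)) 2 o) 0 lam =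
    lam
  rw [h]
  rfl

end SphereSide

/-! ### The shrinker side -/

variable {M : Type*} [TopologicalSpace M] [ChartedSpace (EuclideanSpace ℝ (Fin 3)) M]
  [IsManifold (𝓡 3) ∞ M]
  (g : PseudoRiemannianMetric (𝓡 3) ∞ (EuclideanSpace ℝ (Fin 3)) (TangentSpace (𝓡 3) : M → Type _))
  [g.HasLeviCivita]

namespace DegenerateShrinker

section Along

variable [T2Space M] [ConnectedSpace M]
  (hg : ∀ (x : M) (v : TangentSpace (𝓡 3) x), v ≠ 0 → 0 < g.val x v v)
  {f : M → ℝ} (hf : ContMDiff (𝓡 3) 𝓘(ℝ, ℝ) ∞ f) {lam : ℝ}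
  (hsol : ∀ (x : M) (X Y : TangentSpace (𝓡 3) x),
    g.ricci x X Y + g.hessian f x X Y = lam * g.val x X Y)
  (hRic0 : ∀ (x : M) (w : TangentSpace (𝓡 3) x), 0 ≤ g.ricci x w w)
  (hS : ∀ x, 0 < g.scalarCurvature x) {p₀ : M} {w₀ : TangentSpace (𝓡 3) p₀} (hw₀ : w₀ ≠ 0)
  (hnull : g.ricci p₀ w₀ w₀ = 0)
  {κ : (x : M) → TangentSpace (𝓡 3) x → ℝ}
  (hκ : ∀ (x : M) (w : TangentSpace (𝓡 3) x),
    κ x w = g.val x w w - 2 / g.scalarCurvature x * g.ricci x w w)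
include hg hf hsol hRic0 hS hw₀ hnull

/-- Shorthand: the round metric of `S² ⊂ ℝ³`. -/
local notation "gS" => roundMetric (n := 2) (EuclideanSpace ℝ (Fin 3))

/-- Shorthand: the model plane of `S²`. -/
local notation "E2" => EuclideanSpace ℝ (Fin 2)

omit [g.HasLeviCivita] [T2Space M] [ConnectedSpace M] hg hf hsol hRic0 hS hw₀ hnull in
/-- A normalised frame rotation: for orthonormal `(a₁, a₂, ν)` and `α² + β² = 1`,
`(α a₁ + β a₂, −β a₁ + α a₂, ν)` is orthonormal. [folklore] -/
theorem frame_rotation {p : M} {a₁ a₂ ν : TangentSpace (𝓡 3) p} (h11 : g.val p a₁ a₁ = 1)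
    (h22 : g.val p a₂ a₂ = 1) (h12 : g.val p a₁ a₂ = 0) (h1ν : g.val p a₁ ν = 0)
    (h2ν : g.val p a₂ ν = 0) {α β : ℝ} (hαβ : α ^ 2 + β ^ 2 = 1) :
    g.val p (α • a₁ + β • a₂) (α • a₁ + β • a₂) = 1 ∧
    g.val p (-β • a₁ + α • a₂) (-β • a₁ + α • a₂) = 1 ∧
    g.val p (α • a₁ + β • a₂) (-β • a₁ + α • a₂) = 0 ∧
    g.val p (α • a₁ + β • a₂) ν = 0 ∧ g.val p (-β • a₁ + α • a₂) ν = 0 := by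
  have h21 : g.val p a₂ a₁ = 0 := by rw [g.symm p]; exact h12
  simp only [map_add, map_smul, _root_.add_apply, FunLike.coe_smul, Pi.smul_apply,
    smul_eq_mul, h11, h22, h12, h21, h1ν, h2ν, mul_zero, mul_one, add_zero, zero_add]
  refine ⟨?_, ?_, ?_, trivial, trivial⟩ <;> nlinarith [hαβ]

set_option maxHeartbeats 800000 in
include hκ in
/-- **Cartan's formula in coordinates.** For an orthonormal frame `(a₁, a₂, ν)` at `p` with `ν`
null and `S ≡ 1`: with `v = w₁a₁ + w₂a₂ + σν`, `ξ = x₁a₁ + x₂a₂ + cν`, `L = w₁² + w₂² ≠ 0`,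
`|d(exp_p)_v ξ|² = c² + (x₁w₁ + x₂w₂)²/L + 2 sin²(√L/√2) (x₂w₁ − x₁w₂)²/L²`.
[cite: MunteanuWang2016, Thm. 1.2] [cite: Chavel2006, Thm. II.6.3] -/
theorem val_mfderiv_expMap_coords (hS1 : ∀ x, g.scalarCurvature x = 1)
    (hc : IsGeodesicallyComplete g.leviCivita) {p : M} {a₁ a₂ ν : TangentSpace (𝓡 3) p}
    (h11 : g.val p a₁ a₁ = 1) (h22 : g.val p a₂ a₂ = 1) (hνν : g.val p ν ν = 1)
    (h12 : g.val p a₁ a₂ = 0) (h1ν : g.val p a₁ ν = 0) (h2ν : g.val p a₂ ν = 0)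
    (hν : g.ricci p ν ν = 0) {w₁ w₂ : ℝ} (hL : w₁ ^ 2 + w₂ ^ 2 ≠ 0) (σ x₁ x₂ c : ℝ) :
    g.val (expMap g.leviCivita p (w₁ • a₁ + w₂ • a₂ + σ • ν))
      (mfderiv 𝓘(ℝ, EuclideanSpace ℝ (Fin 3)) (𝓡 3)
        (fun w : EuclideanSpace ℝ (Fin 3) ↦ expMap g.leviCivita p (show TangentSpace (𝓡 3) p from w))
        (show EuclideanSpace ℝ (Fin 3) from w₁ • a₁ + w₂ • a₂ + σ • ν) (x₁ • a₁ + x₂ • a₂ + c • ν))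
      (mfderiv 𝓘(ℝ, EuclideanSpace ℝ (Fin 3)) (𝓡 3)
        (fun w : EuclideanSpace ℝ (Fin 3) ↦ expMap g.leviCivita p (show TangentSpace (𝓡 3) p from w))
        (show EuclideanSpace ℝ (Fin 3) from w₁ • a₁ + w₂ • a₂ + σ • ν) (x₁ • a₁ + x₂ • a₂ + c • ν)) =
      c ^ 2 + (x₁ * w₁ + x₂ * w₂) ^ 2 / (w₁ ^ 2 + w₂ ^ 2) +
        2 * Real.sin (Real.sqrt (w₁ ^ 2 + w₂ ^ 2) / Real.sqrt 2) ^ 2 * (x₂ * w₁ - x₁ * w₂) ^ 2 /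
          (w₁ ^ 2 + w₂ ^ 2) ^ 2 := by
  set r : ℝ := Real.sqrt (w₁ ^ 2 + w₂ ^ 2) with hr
  have hL0 : 0 < w₁ ^ 2 + w₂ ^ 2 := lt_of_le_of_ne (by positivity) (Ne.symm hL)
  have hr0 : 0 < r := Real.sqrt_pos.2 hL0
  have hr2 : r ^ 2 = w₁ ^ 2 + w₂ ^ 2 := Real.sq_sqrt hL0.le
  have hs2 : 0 < Real.sqrt 2 := Real.sqrt_pos.2 (by norm_num)
  have h22' : Real.sqrt 2 ^ 2 = 2 := Real.sq_sqrt (by norm_num)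
  -- the adapted frame `u = (w₁a₁ + w₂a₂)/r`, `n = (−w₂a₁ + w₁a₂)/r`
  have hαβ : (w₁ / r) ^ 2 + (w₂ / r) ^ 2 = 1 := by
    field_simp; rw [hr2]
  obtain ⟨huu, hnn, hun, huν, hnν⟩ := frame_rotation g h11 h22 h12 h1ν h2ν hαβ
  -- the solution `j(t) = (√2/r) sin(r t/√2)` of `j'' = −(r²/2) j`
  have hj : ∀ t, HasDerivAt (fun t ↦ Real.sqrt 2 / r * Real.sin (r * t / Real.sqrt 2))
      (Real.cos (r * t / Real.sqrt 2)) t := by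
    intro t
    have h := ((Real.hasDerivAt_sin _).comp t
      (((hasDerivAt_id' t).const_mul r).div_const (Real.sqrt 2))).const_mul (Real.sqrt 2 / r)
    refine h.congr_deriv ?_
    field_simp
  have hj₁ : ∀ t, HasDerivAt (fun t ↦ Real.cos (r * t / Real.sqrt 2))
      (-(r ^ 2 / 2) * (Real.sqrt 2 / r * Real.sin (r * t / Real.sqrt 2))) t := by
    intro t
    have h := (Real.hasDerivAt_cos _).comp t
      (((hasDerivAt_id' t).const_mul r).div_const (Real.sqrt 2))
    refine h.congr_deriv ?_
    field_simp
    rw [h22']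
    ring
  have h := val_mfderiv_expMap_sq g hg hf hsol hRic0 hS hw₀ hnull hκ hS1 hc huu hnn hνν hun huν hnν
    hν r σ hj hj₁ (by simp) (by simp) (x₁ • a₁ + x₂ • a₂ + c • ν)
  have hv : r • ((w₁ / r) • a₁ + (w₂ / r) • a₂) + σ • ν = w₁ • a₁ + w₂ • a₂ + σ • ν := by
    rw [smul_add, smul_smul, smul_smul, mul_div_cancel₀ _ hr0.ne', mul_div_cancel₀ _ hr0.ne']
  rw [hv] at h
  rw [h]
  have h21 : g.val p a₂ a₁ = 0 := by rw [g.symm p]; exact h12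
  have hν1 : g.val p ν a₁ = 0 := by rw [g.symm p]; exact h1ν
  have hν2 : g.val p ν a₂ = 0 := by rw [g.symm p]; exact h2ν
  simp only [map_add, map_smul, _root_.add_apply, FunLike.coe_smul, Pi.smul_apply, smul_eq_mul,
    h11, h22, h12, h21, h1ν, h2ν, hν1, hν2, hνν, mul_zero, mul_one, add_zero, zero_add]
  rw [← hr2]
  simp only [mul_pow, div_pow, h22']
  field_simp
  ring

set_option maxHeartbeats 800000 in
include hκ in
/-- **Cartan's formula in coordinates, radial case `w = 0`**: `|d(exp_p)_{σν} ξ|² = |ξ|²`.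
[cite: MunteanuWang2016, Thm. 1.2] -/
theorem val_mfderiv_expMap_coords_zero (hS1 : ∀ x, g.scalarCurvature x = 1)
    (hc : IsGeodesicallyComplete g.leviCivita) {p : M} {a₁ a₂ ν : TangentSpace (𝓡 3) p}
    (h11 : g.val p a₁ a₁ = 1) (h22 : g.val p a₂ a₂ = 1) (hνν : g.val p ν ν = 1)
    (h12 : g.val p a₁ a₂ = 0) (h1ν : g.val p a₁ ν = 0) (h2ν : g.val p a₂ ν = 0)
    (hν : g.ricci p ν ν = 0) (σ x₁ x₂ c : ℝ) :
    g.val (expMap g.leviCivita p ((0 : ℝ) • a₁ + σ • ν))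
      (mfderiv 𝓘(ℝ, EuclideanSpace ℝ (Fin 3)) (𝓡 3)
        (fun w : EuclideanSpace ℝ (Fin 3) ↦ expMap g.leviCivita p (show TangentSpace (𝓡 3) p from w))
        (show EuclideanSpace ℝ (Fin 3) from (0 : ℝ) • a₁ + σ • ν) (x₁ • a₁ + x₂ • a₂ + c • ν))
      (mfderiv 𝓘(ℝ, EuclideanSpace ℝ (Fin 3)) (𝓡 3)
        (fun w : EuclideanSpace ℝ (Fin 3) ↦ expMap g.leviCivita p (show TangentSpace (𝓡 3) p from w))
        (show EuclideanSpace ℝ (Fin 3) from (0 : ℝ) • a₁ + σ • ν) (x₁ • a₁ + x₂ • a₂ + c • ν)) =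
      c ^ 2 + x₁ ^ 2 + x₂ ^ 2 := by
  have hj : ∀ t : ℝ, HasDerivAt (fun t : ℝ ↦ t) ((fun _ ↦ (1 : ℝ)) t) t := fun t ↦ hasDerivAt_id' t
  have hj₁ : ∀ t : ℝ, HasDerivAt (fun _ : ℝ ↦ (1 : ℝ)) (-((0 : ℝ) ^ 2 / 2) * t) t := fun t ↦
    (hasDerivAt_const t (1 : ℝ)).congr_deriv (by ring)
  have h := val_mfderiv_expMap_sq g hg hf hsol hRic0 hS hw₀ hnull hκ hS1 hc h11 h22 hνν h12 h1ν h2ν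
    hν 0 σ hj hj₁ rfl rfl (x₁ • a₁ + x₂ • a₂ + c • ν)
  rw [h]
  have h21 : g.val p a₂ a₁ = 0 := by rw [g.symm p]; exact h12
  have hν1 : g.val p ν a₁ = 0 := by rw [g.symm p]; exact h1ν
  have hν2 : g.val p ν a₂ = 0 := by rw [g.symm p]; exact h2ν
  simp only [map_add, map_smul, _root_.add_apply, FunLike.coe_smul, Pi.smul_apply, smul_eq_mul,
    h11, h22, h12, h21, h1ν, h2ν, hν1, hν2, hνν, mul_zero, mul_one, add_zero, zero_add]
  ring

set_option maxHeartbeats 800000 in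
include hκ in
/-- **`exp_p^* g = 2 (exp^{S²}_o)^* g_round + 2 dτ²`.** For an orthonormal frame `(a₁, a₂, ν)` at
`p` (`ν` null, `S ≡ 1`) and `g_round`-orthonormal `ε₀, ε₁ ∈ T_oS²`, with
`v = √2(l⁰ a₁ + l¹ a₂) + √2 τ ν`, `ξ = √2(λ⁰ a₁ + λ¹ a₂) + √2 α ν` (`lⁱ = g_round(l, εᵢ)`,
`λⁱ = g_round(λ, εᵢ)`): `|d(exp_p)_v ξ|²_g = 2 |d(exp^{S²}_o)_l λ|²_{g_round} + 2α²` — the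
pull-back of `g` by `exp_p` is the metric of `S²(√2) × ℝ`. [cite: MunteanuWang2016, Thm. 1.2]
[cite: doCarmo1992, Ch. 8, Thm. 2.1] -/
theorem val_mfderiv_expMap_eq_two_mul_sphere (hS1 : ∀ x, g.scalarCurvature x = 1)
    (hc : IsGeodesicallyComplete g.leviCivita) {p : M} {a₁ a₂ ν : TangentSpace (𝓡 3) p}
    (h11 : g.val p a₁ a₁ = 1) (h22 : g.val p a₂ a₂ = 1) (hνν : g.val p ν ν = 1)
    (h12 : g.val p a₁ a₂ = 0) (h1ν : g.val p a₁ ν = 0) (h2ν : g.val p a₂ ν = 0)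
    (hν : g.ricci p ν ν = 0) {o : sphere (0 : EuclideanSpace ℝ (Fin 3)) 1}
    {ε₀ ε₁ : TangentSpace (𝓡 2) o}
    (e00 : (gS).val o ε₀ ε₀ = 1) (e11 : (gS).val o ε₁ ε₁ = 1) (e01 : (gS).val o ε₀ ε₁ = 0)
    (l lam' : TangentSpace (𝓡 2) o) (τ α : ℝ) :
    g.val (expMap g.leviCivita p
        ((Real.sqrt 2 * (gS).val o l ε₀) • a₁ + (Real.sqrt 2 * (gS).val o l ε₁) • a₂ +
          (Real.sqrt 2 * τ) • ν))
      (mfderiv 𝓘(ℝ, EuclideanSpace ℝ (Fin 3)) (𝓡 3)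
        (fun w : EuclideanSpace ℝ (Fin 3) ↦ expMap g.leviCivita p (show TangentSpace (𝓡 3) p from w))
        (show EuclideanSpace ℝ (Fin 3) from
          (Real.sqrt 2 * (gS).val o l ε₀) • a₁ + (Real.sqrt 2 * (gS).val o l ε₁) • a₂ +
            (Real.sqrt 2 * τ) • ν)
        ((Real.sqrt 2 * (gS).val o lam' ε₀) • a₁ + (Real.sqrt 2 * (gS).val o lam' ε₁) • a₂ +
          (Real.sqrt 2 * α) • ν))
      (mfderiv 𝓘(ℝ, EuclideanSpace ℝ (Fin 3)) (𝓡 3)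
        (fun w : EuclideanSpace ℝ (Fin 3) ↦ expMap g.leviCivita p (show TangentSpace (𝓡 3) p from w))
        (show EuclideanSpace ℝ (Fin 3) from
          (Real.sqrt 2 * (gS).val o l ε₀) • a₁ + (Real.sqrt 2 * (gS).val o l ε₁) • a₂ +
            (Real.sqrt 2 * τ) • ν)
        ((Real.sqrt 2 * (gS).val o lam' ε₀) • a₁ + (Real.sqrt 2 * (gS).val o lam' ε₁) • a₂ +
          (Real.sqrt 2 * α) • ν)) =
      2 * (gS).val (SphereLocalIsometry.sphereExp (EuclideanSpace ℝ (Fin 3)) 2 o l)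
        (mfderiv 𝓘(ℝ, E2) (𝓡 2) (SphereLocalIsometry.sphereExp (EuclideanSpace ℝ (Fin 3)) 2 o) l lam')
        (mfderiv 𝓘(ℝ, E2) (𝓡 2) (SphereLocalIsometry.sphereExp (EuclideanSpace ℝ (Fin 3)) 2 o) l lam') +
      2 * α ^ 2 := by
  have hs2 : 0 < Real.sqrt 2 := Real.sqrt_pos.2 (by norm_num)
  have h22' : Real.sqrt 2 ^ 2 = 2 := Real.sq_sqrt (by norm_num)
  set l0 := (gS).val o l ε₀ with hl0
  set l1 := (gS).val o l ε₁ with hl1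
  set m0 := (gS).val o lam' ε₀ with hm0
  set m1 := (gS).val o lam' ε₁ with hm1
  by_cases hL : l0 ^ 2 + l1 ^ 2 = 0
  · -- radial case: `l = 0`
    have hl00 : l0 = 0 := by nlinarith [sq_nonneg l0, sq_nonneg l1]
    have hl10 : l1 = 0 := by nlinarith [sq_nonneg l0, sq_nonneg l1]
    have hlz : l = 0 := by
      rw [eq_coords_roundMetric e00 e11 e01 l, ← hl0, ← hl1, hl00, hl10, zero_smul, zero_smul,
        add_zero]
    have hv : (Real.sqrt 2 * l0) • a₁ + (Real.sqrt 2 * l1) • a₂ + (Real.sqrt 2 * τ) • ν =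
        (0 : ℝ) • a₁ + (Real.sqrt 2 * τ) • ν := by
      rw [hl00, hl10, mul_zero, zero_smul, zero_smul, zero_add, zero_add]
    rw [hv, val_mfderiv_expMap_coords_zero g hg hf hsol hRic0 hS hw₀ hnull hκ hS1 hc h11 h22 hνν h12
      h1ν h2ν hν, hlz, sphere_mfderiv_zero_apply, sphereExp_zero']
    have hmm2 : (gS).val o lam' lam' = m0 ^ 2 + m1 ^ 2 := by
      rw [roundMetric_eq_coords e00 e11 e01 lam' lam']; ring
    rw [hmm2, mul_pow, mul_pow, mul_pow, h22']
    ring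
  · have e2 : (Real.sqrt 2 * l0) ^ 2 + (Real.sqrt 2 * l1) ^ 2 = 2 * (l0 ^ 2 + l1 ^ 2) := by
      linear_combination (l0 ^ 2 + l1 ^ 2) * h22'
    have hL2 : (Real.sqrt 2 * l0) ^ 2 + (Real.sqrt 2 * l1) ^ 2 ≠ 0 := by
      rw [e2]; exact mul_ne_zero two_ne_zero hL
    rw [val_mfderiv_expMap_coords g hg hf hsol hRic0 hS hw₀ hnull hκ hS1 hc h11 h22 hνν h12 h1ν h2ν hν
      hL2, sphere_val_mfderiv_coords e00 e11 e01 hL lam']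
    simp only [← hl0, ← hl1, ← hm0, ← hm1]
    have e1 : Real.sqrt 2 * m0 * (Real.sqrt 2 * l0) + Real.sqrt 2 * m1 * (Real.sqrt 2 * l1) =
        2 * (m0 * l0 + m1 * l1) := by linear_combination (m0 * l0 + m1 * l1) * h22'
    have e3 : Real.sqrt 2 * m1 * (Real.sqrt 2 * l0) - Real.sqrt 2 * m0 * (Real.sqrt 2 * l1) =
        2 * (m1 * l0 - m0 * l1) := by linear_combination (m1 * l0 - m0 * l1) * h22'
    have e4 : (Real.sqrt 2 * α) ^ 2 = 2 * α ^ 2 := by linear_combination α ^ 2 * h22'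
    have hsq : Real.sqrt (2 * (l0 ^ 2 + l1 ^ 2)) / Real.sqrt 2 = Real.sqrt (l0 ^ 2 + l1 ^ 2) := by
      rw [Real.sqrt_mul (by norm_num : (0 : ℝ) ≤ 2), mul_div_cancel_left₀ _ hs2.ne']
    rw [e1, e2, e3, e4, hsq]
    field_simp
    ring

end Along

end DegenerateShrinker

end Literature.Geometry.Riemannian

end
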